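import Summits.CriticalPhenomena.PercolationContinuityZ3.Theorems.PercNonProliferationFreeBoxPowerSavingSprinkledClosure
import Summits.CriticalPhenomena.PercolationContinuityZ3.Theses.PercNonProliferation
import HarnessLib

/-!
# Crux `PercNonProliferation.FreeBoxPowerSaving` (stmt-CriticalPhenomena-4447), line `Sketch-r2-ideator5`
# (card `subcritical-runaway-closure`) — stub `stub_sprinkledResidualIffCrux` (the RESIDUAL DICTIONARY)

Helper file for the checked skeleton `Cruxes/FreeBoxPowerSaving/Lines/Sketch_r2_ideator5.lean`
(lead prover-line-stmt-CriticalPhenomena-4447-c4-0).  Makes the skeleton's §4–§5 analysis importable: the line's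
open residual — in its plain form ("no last violating scale below `p_c`") and in its registered sprinkled form — is
EQUIVALENT to the crux.  Proves exactly the registered stub `stub_sprinkledResidualIffCrux`; lands with
`--supports stmt-CriticalPhenomena-4447`.

* `ResidualDictionary.noLast_of_crux` — crux ⟹ plain residual, VACUOUSLY: if the crux holds with exponent `a₀` then
  for `a = min(a₀/2, 1)` and `p < p_c`, `s_p(n) ≤ s_{p_c}(n) ≤ 27 max(C₀,1) n^{3-a₀} < n^{3-a}` eventually
  (`freePairAverage_mono`), so the threshold `n^{3-a}` is never reached and "no last violating scale" holds emptily.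
* `ResidualDictionary.sprinkled_of_noLast` — plain ⟹ sprinkled (zero sprinkle, zero budget; monotonicity in `p`).
* `ResidualDictionary.crux_of_sprinkled` — sprinkled ⟹ crux (`stub_sprinkledClosure`, p127893).
* `stub_sprinkledResidualIffCrux`, `ResidualDictionary.noLast_iff_crux` — the equivalences;
  `ResidualDictionary.noLast_exponent_le_two` — any instance of the plain residual has `a ≤ 2` (DCT floor,
  `freeBoxPowerSaving_exponent_le_two`).

So the residual of this line, like every residual filed on this crux before it (QG-NAS, poly-rare shattering, (I₁) ∧ (B),
EUC, CesaroBlocking), cannot be refuted without refuting the crux nor proved without proving it.  No new definitions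
(`pairSum`, `fa2` are the tree's `FreeBoxPowerSavingNegative` vocabulary).
-/

noncomputable section

open MeasureTheory Filter
open Literature.Probability.Percolation Literature.Probability.LatticeModels
open Summit.CriticalPhenomena.PercolationContinuityZ3.FreeBoxPowerSavingNegative
  (pairSum fa2 card_box_pos card_box_real)
open Summit.CriticalPhenomena.PercolationContinuityZ3.Theorems.FreeBoxSparse.Negative
  (freePairAverage_mono freeBoxPowerSaving_exponent_le_two)
open scoped BigOperators Topology

namespace Summit.CriticalPhenomena.PercolationContinuityZ3.FreeBoxPowerSavingLine

namespace ResidualDictionary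

/-- `|B(n)| ≤ 27 n³` for `n ≥ 1`. [folklore] -/
theorem card_box_le (n : ℕ) (hn : 1 ≤ n) : ((box 3 n).card : ℝ) ≤ 27 * (n : ℝ) ^ (3 : ℕ) := by
  rw [card_box_real]
  have h1 : (1 : ℝ) ≤ n := by exact_mod_cast hn
  have h2 : (2 * (n : ℝ) + 1) ≤ 3 * n := by linarith
  have h0 : (0 : ℝ) ≤ 2 * (n : ℝ) + 1 := by linarith
  calc (2 * (n : ℝ) + 1) ^ 3 ≤ (3 * (n : ℝ)) ^ 3 := pow_le_pow_left₀ h0 h2 3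
    _ = 27 * (n : ℝ) ^ (3 : ℕ) := by ring

/-- **crux ⟹ plain residual (vacuously).**  If `FA₂(p_c,n) ≤ C₀ n^{-a₀}` for `n ≥ 1`, then with `a = min(a₀/2,1)`,
`C = 1` and `n₀ = max N 1` (`N` such that `27 max(C₀,1) < n^{a₀-a}` beyond it), no `p < p_c` and `n ≥ n₀` ever has
`s_p(n) ≥ n^{3-a}` (`s_p(n) = FA₂(p,n)|B(n)| ≤ FA₂(p_c,n)·27n³` by `freePairAverage_mono`), so "no last violating
scale" holds emptily. [folklore] -/
theorem noLast_of_crux (h : Summit.CriticalPhenomena.PercolationContinuityZ3.Theses.PercNonProliferation.FreeBoxPowerSaving) :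
    ∃ (a C : ℝ) (n₀ : ℕ), 0 < a ∧ a < 3 ∧ 0 < C ∧ 1 ≤ n₀ ∧
      ∀ p : unitInterval, (p : ℝ) < criticalProb (zdGraph 3) (0 : Site 3) → ∀ n : ℕ, n₀ ≤ n →
        C * (n : ℝ) ^ (3 - a) ≤ pairSum p n / ((box 3 n).card : ℝ) →
          ∃ m : ℕ, n < m ∧ C * (m : ℝ) ^ (3 - a) ≤ pairSum p m / ((box 3 m).card : ℝ) := by
  obtain ⟨a₀, C₀, ha₀, h⟩ := h
  set a : ℝ := min (a₀ / 2) 1 with ha_def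
  have ha : 0 < a := lt_min (by linarith) one_pos
  have ha3 : a < 3 := (min_le_right _ _).trans_lt (by norm_num)
  have haa₀ : a < a₀ := (min_le_left _ _).trans_lt (by linarith)
  set K : ℝ := 27 * max C₀ 1 with hK_def
  obtain ⟨N, hN⟩ : ∃ N : ℕ, ∀ n : ℕ, N ≤ n → K < (n : ℝ) ^ (a₀ - a) := by
    have ht : Tendsto (fun n : ℕ => (n : ℝ) ^ (a₀ - a)) atTop atTop :=
      (tendsto_rpow_atTop (by linarith)).comp tendsto_natCast_atTop_atTop
    exact eventually_atTop.1 (ht.eventually_gt_atTop K)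
  refine ⟨a, 1, max N 1, ha, ha3, one_pos, le_max_right _ _, ?_⟩
  intro p hp n hn hviol
  exfalso
  have hn1 : 1 ≤ n := (le_max_right _ _).trans hn
  have hNn : N ≤ n := (le_max_left _ _).trans hn
  have hnpos : (0 : ℝ) < n := by exact_mod_cast hn1
  have hp' : p ≤ criticalProbI 3 := by
    apply le_of_lt
    change (p : ℝ) < (criticalProbI 3 : ℝ) at hp
    exact_mod_cast hp
  have hmono := freePairAverage_mono hp' n
  have hcrux := h n hn1
  change fa2 p n ≤ fa2 (criticalProbI 3) n at hmono
  change fa2 (criticalProbI 3) n ≤ C₀ * (n : ℝ) ^ (-a₀) at hcrux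
  have hcardpos := card_box_pos n
  have hcard := card_box_le n hn1
  have hna₀ : 0 ≤ (n : ℝ) ^ (-a₀) := Real.rpow_nonneg hnpos.le _
  have hs : pairSum p n / ((box 3 n).card : ℝ) ≤ K * ((n : ℝ) ^ (-a₀) * (n : ℝ) ^ (3 : ℕ)) := by
    have hfa : pairSum p n / ((box 3 n).card : ℝ) = fa2 p n * ((box 3 n).card : ℝ) := by
      unfold fa2; field_simp
    rw [hfa]
    calc fa2 p n * ((box 3 n).card : ℝ)
        ≤ (max C₀ 1 * (n : ℝ) ^ (-a₀)) * (27 * (n : ℝ) ^ (3 : ℕ)) := by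
          apply mul_le_mul _ hcard hcardpos.le (mul_nonneg (le_max_of_le_right zero_le_one) hna₀)
          exact (hmono.trans hcrux).trans (mul_le_mul_of_nonneg_right (le_max_left _ _) hna₀)
      _ = K * ((n : ℝ) ^ (-a₀) * (n : ℝ) ^ (3 : ℕ)) := by rw [hK_def]; ring
  have hpow3 : (0 : ℝ) < (n : ℝ) ^ (3 : ℕ) := pow_pos hnpos 3
  have hna₀' : 0 < (n : ℝ) ^ (-a₀) := Real.rpow_pos_of_pos hnpos _
  have hlt : K * ((n : ℝ) ^ (-a₀) * (n : ℝ) ^ (3 : ℕ)) < (n : ℝ) ^ (3 - a) := by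
    have h1 : K * ((n : ℝ) ^ (-a₀) * (n : ℝ) ^ (3 : ℕ)) <
        (n : ℝ) ^ (a₀ - a) * ((n : ℝ) ^ (-a₀) * (n : ℝ) ^ (3 : ℕ)) :=
      mul_lt_mul_of_pos_right (hN n hNn) (mul_pos hna₀' hpow3)
    have h2 : (n : ℝ) ^ (a₀ - a) * ((n : ℝ) ^ (-a₀) * (n : ℝ) ^ (3 : ℕ)) = (n : ℝ) ^ (3 - a) := by
      rw [← mul_assoc, ← Real.rpow_add hnpos, ← Real.rpow_natCast, ← Real.rpow_add hnpos]
      norm_num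
      ring_nf
    rw [h2] at h1
    exact h1
  have := hviol.trans hs
  linarith

/-- **plain ⟹ sprinkled residual** (zero sprinkle, zero budget: `0 < p_c(ℤ³)`, `0 ≤ C n^{3-a}`, and a violation at
`(p, m)` persists at every `q ≥ p` by monotonicity in the parameter). [folklore] -/
theorem sprinkled_of_noLast
    (h : ∃ (a C : ℝ) (n₀ : ℕ), 0 < a ∧ a < 3 ∧ 0 < C ∧ 1 ≤ n₀ ∧
      ∀ p : unitInterval, (p : ℝ) < criticalProb (zdGraph 3) (0 : Site 3) → ∀ n : ℕ, n₀ ≤ n →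
        C * (n : ℝ) ^ (3 - a) ≤ pairSum p n / ((box 3 n).card : ℝ) →
          ∃ m : ℕ, n < m ∧ C * (m : ℝ) ^ (3 - a) ≤ pairSum p m / ((box 3 m).card : ℝ)) :
      ∃ (a C : ℝ) (n₀ : ℕ) (δ ε : ℕ → ℝ), 0 < a ∧ a < 3 ∧ 0 < C ∧ 1 ≤ n₀ ∧
        (∀ n : ℕ, 0 ≤ δ n) ∧ (∀ n : ℕ, 0 ≤ ε n) ∧ (∀ n m : ℕ, n < m → δ n + ε m ≤ ε n) ∧
        (∀ n : ℕ, n₀ ≤ n → ε n < criticalProb (zdGraph 3) (0 : Site 3)) ∧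
        (∀ n : ℕ, n₀ ≤ n →
          ε n * (((box 3 n).card : ℝ) * (((box 3 n).sym2).card : ℝ)) ≤ C * (n : ℝ) ^ (3 - a)) ∧
        ∀ (p q : unitInterval) (n : ℕ), n₀ ≤ n → (q : ℝ) < criticalProb (zdGraph 3) (0 : Site 3) →
          (p : ℝ) + δ n ≤ (q : ℝ) →
          C * (n : ℝ) ^ (3 - a) ≤
            (∑ x ∈ box 3 n, ∑ y ∈ box 3 n,
              (bondPercolation (zdGraph 3) p).real (openConnIn (↑(box 3 n) : Set (Site 3)) x y)) /
              ((box 3 n).card : ℝ) →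
          ∃ m : ℕ, n < m ∧ C * (m : ℝ) ^ (3 - a) ≤
            (∑ x ∈ box 3 m, ∑ y ∈ box 3 m,
              (bondPercolation (zdGraph 3) q).real (openConnIn (↑(box 3 m) : Set (Site 3)) x y)) /
              ((box 3 m).card : ℝ) := by
  obtain ⟨a, C, n₀, ha, ha3, hC, hn₀, h⟩ := h
  refine ⟨a, C, n₀, fun _ => 0, fun _ => 0, ha, ha3, hC, hn₀, fun _ => le_rfl, fun _ => le_rfl,
    fun _ _ _ => by simp, fun _ _ => criticalProb_zd_pos 3 (by norm_num), fun n _ => ?_, ?_⟩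
  · rw [zero_mul]
    exact mul_nonneg hC.le (Real.rpow_nonneg (Nat.cast_nonneg n) _)
  · intro p q n hn hq hpq hv
    have hpq' : p ≤ q := by
      apply Subtype.coe_le_coe.1
      simpa using hpq
    have hp : (p : ℝ) < criticalProb (zdGraph 3) (0 : Site 3) := lt_of_le_of_lt (Subtype.coe_le_coe.2 hpq') hq
    obtain ⟨m, hm, hvm⟩ := h p hp n hn hv
    exact ⟨m, hm, hvm.trans (SprinkledClosure.pairSum_div_card_mono m hpq')⟩

/-- **sprinkled residual ⟹ crux** (the sprinkled closure `stub_sprinkledClosure`, p127893). [folklore] -/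
theorem crux_of_sprinkled
    (h :
      ∃ (a C : ℝ) (n₀ : ℕ) (δ ε : ℕ → ℝ), 0 < a ∧ a < 3 ∧ 0 < C ∧ 1 ≤ n₀ ∧
        (∀ n : ℕ, 0 ≤ δ n) ∧ (∀ n : ℕ, 0 ≤ ε n) ∧ (∀ n m : ℕ, n < m → δ n + ε m ≤ ε n) ∧
        (∀ n : ℕ, n₀ ≤ n → ε n < criticalProb (zdGraph 3) (0 : Site 3)) ∧
        (∀ n : ℕ, n₀ ≤ n →
          ε n * (((box 3 n).card : ℝ) * (((box 3 n).sym2).card : ℝ)) ≤ C * (n : ℝ) ^ (3 - a)) ∧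
        ∀ (p q : unitInterval) (n : ℕ), n₀ ≤ n → (q : ℝ) < criticalProb (zdGraph 3) (0 : Site 3) →
          (p : ℝ) + δ n ≤ (q : ℝ) →
          C * (n : ℝ) ^ (3 - a) ≤
            (∑ x ∈ box 3 n, ∑ y ∈ box 3 n,
              (bondPercolation (zdGraph 3) p).real (openConnIn (↑(box 3 n) : Set (Site 3)) x y)) /
              ((box 3 n).card : ℝ) →
          ∃ m : ℕ, n < m ∧ C * (m : ℝ) ^ (3 - a) ≤
            (∑ x ∈ box 3 m, ∑ y ∈ box 3 m,
              (bondPercolation (zdGraph 3) q).real (openConnIn (↑(box 3 m) : Set (Site 3)) x y)) /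
              ((box 3 m).card : ℝ)) :
    Summit.CriticalPhenomena.PercolationContinuityZ3.Theses.PercNonProliferation.FreeBoxPowerSaving := by
  obtain ⟨a, C, n₀, δ, ε, ha, ha3, hC, hn₀, hδ, hε, hbud, hεpc, hεbud, H⟩ := h
  obtain ⟨C', hC'⟩ := stub_sprinkledClosure a C n₀ δ ε ha ha3 hC hn₀ hδ hε hbud hεpc hεbud H
  exact ⟨a, C', ha, hC'⟩

/-- **The plain residual is crux-EQUIVALENT.** [folklore] -/
theorem noLast_iff_crux :
    (∃ (a C : ℝ) (n₀ : ℕ), 0 < a ∧ a < 3 ∧ 0 < C ∧ 1 ≤ n₀ ∧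
      ∀ p : unitInterval, (p : ℝ) < criticalProb (zdGraph 3) (0 : Site 3) → ∀ n : ℕ, n₀ ≤ n →
        C * (n : ℝ) ^ (3 - a) ≤ pairSum p n / ((box 3 n).card : ℝ) →
          ∃ m : ℕ, n < m ∧ C * (m : ℝ) ^ (3 - a) ≤ pairSum p m / ((box 3 m).card : ℝ)) ↔
    Summit.CriticalPhenomena.PercolationContinuityZ3.Theses.PercNonProliferation.FreeBoxPowerSaving :=
  ⟨fun h => crux_of_sprinkled (sprinkled_of_noLast h), noLast_of_crux⟩

/-- **Any instance of the plain residual has exponent `a ≤ 2`** (closure with the SAME exponent, then the DCT floor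
`FA₂(p_c,n) ≥ c n^{-2}`, `freeBoxPowerSaving_exponent_le_two`). [folklore] -/
theorem noLast_exponent_le_two {a C : ℝ} {n₀ : ℕ} (ha : 0 < a) (ha3 : a < 3) (hC : 0 < C) (hn₀ : 1 ≤ n₀)
    (h : ∀ p : unitInterval, (p : ℝ) < criticalProb (zdGraph 3) (0 : Site 3) → ∀ n : ℕ, n₀ ≤ n →
      C * (n : ℝ) ^ (3 - a) ≤ pairSum p n / ((box 3 n).card : ℝ) →
        ∃ m : ℕ, n < m ∧ C * (m : ℝ) ^ (3 - a) ≤ pairSum p m / ((box 3 m).card : ℝ)) : a ≤ 2 := by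
  obtain ⟨C', hC'⟩ := RunawayClosure.fa2_criticalProbI_powerSaving ha ha3 hC hn₀ h
  exact freeBoxPowerSaving_exponent_le_two (a := a) (C := C') (fun n hn => hC' n hn)

end ResidualDictionary

open ResidualDictionary

/-- **stub_sprinkledResidualIffCrux (RESIDUAL DICTIONARY of line `Sketch-r2-ideator5`): the registered open residual
`stub_sprinkledResidual` is EQUIVALENT to the crux `FreeBoxPowerSaving`** — `⟸` vacuously through the plain residual
(`noLast_of_crux`, `sprinkled_of_noLast`), `⟹` by the sprinkled closure (`crux_of_sprinkled`, p127893). [folklore] -/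
theorem stub_sprinkledResidualIffCrux :
    (
      ∃ (a C : ℝ) (n₀ : ℕ) (δ ε : ℕ → ℝ), 0 < a ∧ a < 3 ∧ 0 < C ∧ 1 ≤ n₀ ∧
        (∀ n : ℕ, 0 ≤ δ n) ∧ (∀ n : ℕ, 0 ≤ ε n) ∧ (∀ n m : ℕ, n < m → δ n + ε m ≤ ε n) ∧
        (∀ n : ℕ, n₀ ≤ n → ε n < criticalProb (zdGraph 3) (0 : Site 3)) ∧
        (∀ n : ℕ, n₀ ≤ n →
          ε n * (((box 3 n).card : ℝ) * (((box 3 n).sym2).card : ℝ)) ≤ C * (n : ℝ) ^ (3 - a)) ∧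
        ∀ (p q : unitInterval) (n : ℕ), n₀ ≤ n → (q : ℝ) < criticalProb (zdGraph 3) (0 : Site 3) →
          (p : ℝ) + δ n ≤ (q : ℝ) →
          C * (n : ℝ) ^ (3 - a) ≤
            (∑ x ∈ box 3 n, ∑ y ∈ box 3 n,
              (bondPercolation (zdGraph 3) p).real (openConnIn (↑(box 3 n) : Set (Site 3)) x y)) /
              ((box 3 n).card : ℝ) →
          ∃ m : ℕ, n < m ∧ C * (m : ℝ) ^ (3 - a) ≤
            (∑ x ∈ box 3 m, ∑ y ∈ box 3 m,
              (bondPercolation (zdGraph 3) q).real (openConnIn (↑(box 3 m) : Set (Site 3)) x y)) /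
              ((box 3 m).card : ℝ)) ↔
    Summit.CriticalPhenomena.PercolationContinuityZ3.Theses.PercNonProliferation.FreeBoxPowerSaving :=
  ⟨crux_of_sprinkled, fun h => sprinkled_of_noLast (noLast_of_crux h)⟩

end Summit.CriticalPhenomena.PercolationContinuityZ3.FreeBoxPowerSavingLine

end
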